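/-
Copyright (c) 2026 the pub-hodgecm-mathlib formalisation cell (harness21).  Prover seat hodgecm-mathlib-K2E1-p09 (g4), Track B ∕ K2-LIT,
h413 = `stmt-HodgeConjecture-24833`, line `K2_E1_TraceFormulaBeta`, campaign RES-RANK-ONE, page «EIS-RANK-ONE», SPEC «EIS-R6»: the ANALYTIC binders `hint` (R6c ★ p857469) and `hfin`
(R3 bridge ★ p857392 §3) from CONTINUITY + a fundamental domain with COMPACT CLOSURE; self-dealt (α) 2026-09-04T05:04Z while the «EIS-R6f-ii» spec is written.
-/
import Summits.HodgeConjecture.HodgeConjecture.Theorems.K2E1EisensteinSeriesLeftRight      -- ★ p857392 (this seat): the R3 bridge (§3's `hfin` binder), `eisensteinSeriesU_eq_tsum_borelQuotient`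
import Summits.HodgeConjecture.HodgeConjecture.Theorems.K2E1EisensteinSeriesRegularity     -- ★ p857362 (this seat): R4a kit `continuous_tsum_of_locallyUniformMajorant`
import HarnessLib

/-!
# h413 ∕ Track B «K2-LIT», page EIS-RANK-ONE — `K2E1EisensteinAnalyticBinders`: `IntegrableOn (u ↦ φ(u g)) 𝓕 ν` and `∫⁻_𝓕 Σ_q ‖f(q̃⁻¹ u g)‖ dν < ∞` from continuity and
# a fundamental domain with compact closure

Cell `pub/hodgecm-mathlib`, crux H413 = `stmt-HodgeConjecture-24833`, route `HCCMUnconditional`; dealer K2E1-plan (g3).  THEOREMS ONLY (no `def`, no `instance`, no `notation`, no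
named-fact hypothesis, no `sorry`); lane `--kind proof --supports stmt-HodgeConjecture-24833 --as helper` (count-neutral).  Mathlib-generic §1; Mok-typed §2.

* §1 GENERIC (a topological group `G`, a subgroup `N` with its subspace topology and Borel σ-algebra, a measure `ν` on `↥N` finite on compacts, `𝓕 ⊆ N` with COMPACT CLOSURE):
  `integrableOn_translate_of_continuous` — `φ` continuous ⟹ `u ↦ φ(u g)` integrable on `𝓕` (the `hint` binder of R6c ★ `borelConstantTerm_truncation_eisensteinSeriesU_eq_zero_of_lt`);
  `setLIntegral_tsum_enorm_lt_top_of_continuous` — for a family `F q : G → ℂ` with `y ↦ Σ'_q ‖F q y‖` summable and CONTINUOUS, `∫⁻_{u∈𝓕} Σ'_q ‖F q (u g)‖ₑ dν < ∞` (the `hfin`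
  binder of ★ p857392 §3 ∕ ★ p857309); and the R4a junction `continuous_tsum_norm_of_locallyUniformMajorant` (a locally uniform summable majorant of the `‖F q ·‖` makes
  `y ↦ Σ'_q ‖F q y‖` continuous — ★ p857362 applied to the norms).
* §2 MOK `quasiSplit F E c N`: the `hfin` binder of ★ p857392 `borelConstantTerm_eisensteinSeriesU_two ∕ _three` in ITS OWN SPELLING (`Σ'_{p ∈ Γ⧸B_Γ} ‖f(p̃⁻¹ u g)‖ₑ`) from a locally
  uniform summable majorant of p08's LEFT terms `q ↦ f(ι(q.out) y)` on `B(F)\U(J_N)(F)` (★ (G′) `exists_locallyUniform_majorant_flatSectionU_…` delivers it for flat sections) —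
  through ★ p857392 §2 `eisensteinSeriesU_eq_tsum_borelQuotient` applied to `‖f‖`.

HONEST LABEL.  Count-neutral helper; proves no printed statement; HC_CM is proved only modulo the 7 printed citations (2 remaining named inputs: hLiu418 =
`stmt-HodgeConjecture-24832`, h413 = `stmt-HodgeConjecture-24833`) until rung 0 closes.

## References
* [MoeglinWaldspurger1995] C. Mœglin, J.-L. Waldspurger, *Spectral decomposition and Eisenstein series* (1995), II.1.5 (convergence is locally uniform, hence `E` is continuous), I.2.6.
* [Garrett2018] P. Garrett, *Modern Analysis of Automorphic Forms by Example* 1 (2018), §2.8, §3.10 (Cor. 3.10.2).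
-/

set_option autoImplicit false
set_option linter.dupNamespace false  -- the mandated namespace repeats the summit's segment (`HodgeConjecture.HodgeConjecture`)

noncomputable section
open MeasureTheory Measure Set Filter Topology NumberField IsDedekindDomain Matrix MulAction
open Literature.NumberTheory.Automorphic Literature.NumberTheory.Automorphic.UnitaryGroup AdelicGroupData
open Summit.HodgeConjecture.HodgeConjecture.Cruxes.H413.K2E1BorelEisensteinU
open Summit.HodgeConjecture.HodgeConjecture.Cruxes.H413.K2E1PseudoEisensteinConstantTermU
open Summit.HodgeConjecture.HodgeConjecture.Cruxes.H413.K2E1EisensteinSeriesLeftRight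
open Summit.HodgeConjecture.HodgeConjecture.Cruxes.H413.K2E1EisensteinSeriesRegularity
open scoped ENNReal NNReal MatrixGroups

namespace Summit.HodgeConjecture.HodgeConjecture.Cruxes.H413.K2E1EisensteinAnalyticBinders

/-! ## §1 Generic: integrability on a fundamental domain with compact closure -/

section Generic

variable {G : Type*} [Group G] [TopologicalSpace G] [IsTopologicalGroup G] (N : Subgroup G) [MeasurableSpace N] [BorelSpace N]
  (ν : Measure N) [IsFiniteMeasureOnCompacts ν]

/-- **THE `hint` BINDER**: for a CONTINUOUS `φ : G → ℂ` and `𝓕 ⊆ N` with compact closure, `u ↦ φ(u g)` is integrable on `𝓕` for every measure finite on compacts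
(Mathlib `ContinuousOn.integrableOn_compact` on `closure 𝓕`). [cite: MoeglinWaldspurger1995, I.2.6] -/
theorem integrableOn_translate_of_continuous [T2Space G] {E' : Type*} [NormedAddCommGroup E'] {φ : G → E'} (hφ : Continuous φ) {𝓕 : Set N}
    (h𝓕 : IsCompact (closure 𝓕)) (g : G) : IntegrableOn (fun u : N => φ ((u : G) * g)) 𝓕 ν :=
  ((hφ.comp (continuous_subtype_val.mul continuous_const)).continuousOn.integrableOn_compact h𝓕).mono_set subset_closure

omit [Group G] [TopologicalSpace G] [IsTopologicalGroup G] in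
/-- Pointwise: `Σ'_q ‖F q y‖ₑ = ‖Σ'_q ‖F q y‖‖ₑ` when the real series is summable. [folklore] -/
theorem tsum_enorm_eq_enorm_tsum_norm {Q : Type*} {F : Q → G → ℂ} {y : G} (hsum : Summable fun q : Q => ‖F q y‖) :
    ∑' q : Q, ‖F q y‖ₑ = ‖∑' q : Q, ‖F q y‖‖ₑ := by
  rw [Real.enorm_of_nonneg (tsum_nonneg fun q => norm_nonneg _), ENNReal.ofReal_tsum_of_nonneg (fun q => norm_nonneg _) hsum]
  exact tsum_congr fun q => (ofReal_norm _).symm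

/-- **THE `hfin` BINDER**: for a family `F q : G → ℂ` whose norm series `y ↦ Σ'_q ‖F q y‖` is summable and CONTINUOUS, and `𝓕 ⊆ N` with compact closure,
`∫⁻_{u ∈ 𝓕} Σ'_q ‖F q (u g)‖ₑ dν < ∞`. [cite: MoeglinWaldspurger1995, II.1.5] [cite: Garrett2018, §3.10] -/
theorem setLIntegral_tsum_enorm_lt_top_of_continuous [T2Space G] {Q : Type*} {F : Q → G → ℂ} (hsum : ∀ y : G, Summable fun q : Q => ‖F q y‖)
    (hcont : Continuous fun y : G => ∑' q : Q, ‖F q y‖) {𝓕 : Set N} (h𝓕 : IsCompact (closure 𝓕)) (g : G) :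
    ∫⁻ u in 𝓕, (∑' q : Q, ‖F q ((u : G) * g)‖ₑ) ∂ν < ∞ := by
  have hint : IntegrableOn (fun u : N => (∑' q : Q, ‖F q ((u : G) * g)‖ : ℝ)) 𝓕 ν :=
    integrableOn_translate_of_continuous N ν hcont h𝓕 g
  have h := hint.hasFiniteIntegral
  rw [HasFiniteIntegral] at h
  exact lt_of_le_of_lt (lintegral_mono fun u => (tsum_enorm_eq_enorm_tsum_norm (hsum _)).le) h

omit [Group G] [IsTopologicalGroup G] in
/-- **THE R4a JUNCTION**: a locally uniform summable majorant of the terms `‖F q ·‖` makes the NORM series `y ↦ Σ'_q ‖F q y‖` continuous and summable (★ p857362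
`continuous_tsum_of_locallyUniformMajorant` ∕ `summable_of_locallyUniformMajorant` for the real-valued family `(q, y) ↦ ‖F q y‖`). [cite: MoeglinWaldspurger1995, II.1.5] -/
theorem continuous_tsum_norm_of_locallyUniformMajorant {Q : Type*} {F : Q → G → ℂ} (hF : ∀ q : Q, Continuous (F q))
    (hmaj : ∀ y₀ : G, ∃ U ∈ 𝓝 y₀, ∃ u : Q → ℝ, Summable u ∧ ∀ y ∈ U, ∀ q : Q, ‖F q y‖ ≤ u q) :
    (∀ y : G, Summable fun q : Q => ‖F q y‖) ∧ Continuous fun y : G => ∑' q : Q, ‖F q y‖ := by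
  have hmaj' : ∀ y₀ : G, ∃ U ∈ 𝓝 y₀, ∃ u : Q → ℝ, Summable u ∧ ∀ y ∈ U, ∀ q : Q, ‖(fun q y => ‖F q y‖) q y‖ ≤ u q := fun y₀ => by
    obtain ⟨U, hU, u, hu, h⟩ := hmaj y₀
    exact ⟨U, hU, u, hu, fun y hy q => by rw [Real.norm_eq_abs, abs_norm]; exact h y hy q⟩
  exact ⟨fun y => summable_of_locallyUniformMajorant (F := fun q y => ‖F q y‖) hmaj' y,
    continuous_tsum_of_locallyUniformMajorant (F := fun q y => ‖F q y‖) (fun q => (hF q).norm) hmaj'⟩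

/-- All together: **continuous terms + a locally uniform summable majorant + compact closure of `𝓕` ⟹ the `hfin` binder** `∫⁻_{u∈𝓕} Σ'_q ‖F q (u g)‖ₑ dν < ∞`.
[cite: MoeglinWaldspurger1995, II.1.5] [cite: Garrett2018, §3.10] -/
theorem setLIntegral_tsum_enorm_lt_top_of_locallyUniformMajorant [T2Space G] {Q : Type*} {F : Q → G → ℂ} (hF : ∀ q : Q, Continuous (F q))
    (hmaj : ∀ y₀ : G, ∃ U ∈ 𝓝 y₀, ∃ u : Q → ℝ, Summable u ∧ ∀ y ∈ U, ∀ q : Q, ‖F q y‖ ≤ u q) {𝓕 : Set N} (h𝓕 : IsCompact (closure 𝓕)) (g : G) :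
    ∫⁻ u in 𝓕, (∑' q : Q, ‖F q ((u : G) * g)‖ₑ) ∂ν < ∞ :=
  setLIntegral_tsum_enorm_lt_top_of_continuous N ν (continuous_tsum_norm_of_locallyUniformMajorant hF hmaj).1
    (continuous_tsum_norm_of_locallyUniformMajorant hF hmaj).2 h𝓕 g

end Generic

/-! ## §2 Mok's `quasiSplit F E c N`: the `hfin` binder of the R3 bridge from a majorant of p08's LEFT terms -/

section Mok

variable {F E : Type} [Field F] [NumberField F] [Field E] [NumberField E] [Algebra F E] {c : E ≃ₐ[F] E} {N : ℕ}

/-- The norm of a left-`B(F)`-invariant function is left-`B(F)`-invariant (to feed `‖f‖` to ★ p857392 §2). [folklore] -/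
theorem forall_borelU_norm {f : (quasiSplit F E c N).Adelic → ℂ}
    (hf : ∀ b ∈ borelU (c : E →+* E) ((StdForm.antidiagonal N).over E), ∀ x : (quasiSplit F E c N).Adelic, f ((quasiSplit F E c N).toAdelic b * x) = f x) :
    ∀ b ∈ borelU (c : E →+* E) ((StdForm.antidiagonal N).over E), ∀ x : (quasiSplit F E c N).Adelic,
      (fun y => ((‖f y‖ : ℝ) : ℂ)) ((quasiSplit F E c N).toAdelic b * x) = (fun y => ((‖f y‖ : ℝ) : ℂ)) x := fun b hb x => by
  simp only [hf b hb x]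

/-- **THE RIGHT-INDEX NORM SERIES IS THE LEFT-INDEX NORM SERIES**: `Σ'_{p ∈ Γ⧸B_Γ} ‖f(p̃⁻¹ y)‖ = Σ'_{q ∈ B(F)\U(J_N)(F)} ‖f(ι(q.out) y)‖` for left-`B(F)`-invariant `f`
(★ p857392 `eisensteinSeriesU_eq_tsum_borelQuotient` for the function `‖f‖`, read in `ℝ` through `ℂ`). [cite: MoeglinWaldspurger1995, II.1.5] -/
theorem tsum_norm_borelQuotient_eq_tsum_norm {f : (quasiSplit F E c N).Adelic → ℂ}
    (hf : ∀ b ∈ borelU (c : E →+* E) ((StdForm.antidiagonal N).over E), ∀ x : (quasiSplit F E c N).Adelic, f ((quasiSplit F E c N).toAdelic b * x) = f x)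
    (y : (quasiSplit F E c N).Adelic) :
    ((∑' p : (quasiSplit F E c N).quotientSubgroup ⧸ (borelAdelic F E c N).subgroupOf (quasiSplit F E c N).quotientSubgroup,
        ‖f ((((p.out : (quasiSplit F E c N).quotientSubgroup) : (quasiSplit F E c N).Adelic))⁻¹ * y)‖ : ℝ) : ℂ) =
      ((∑' q : Quotient (orbitRel ↥(borelU (c : E →+* E) ((StdForm.antidiagonal N).over E)) ↥(unitaryGroupOfForm (c : E →+* E) ((StdForm.antidiagonal N).over E))),
        ‖f ((quasiSplit F E c N).toAdelic (q.out : ↥(unitaryGroupOfForm (c : E →+* E) ((StdForm.antidiagonal N).over E))) * y)‖ : ℝ) : ℂ) := by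
  rw [Complex.ofReal_tsum, Complex.ofReal_tsum]
  have h := eisensteinSeriesU_eq_tsum_borelQuotient (f := fun y => ((‖f y‖ : ℝ) : ℂ)) (forall_borelU_norm hf) y
  rw [eisensteinSeriesU_def] at h
  exact h.symm

/-- **THE `hfin` BINDER OF ★ p857392 §3 FROM A MAJORANT OF p08's LEFT TERMS**: if the terms `y ↦ f(ι(q.out) y)` are continuous and admit a locally uniform summable majorant on
`B(F)\U(J_N)(F)` (★ (G′) for flat sections, `Re z > 2ρ_H`), then for every measure `ν` on `N(𝔸_F)` finite on compacts, every `𝓕` with compact closure and every `g`: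
`∫⁻_{u∈𝓕} Σ'_{p∈Γ⧸B_Γ} ‖f(p̃⁻¹ u g)‖ₑ dν < ∞`. [cite: MoeglinWaldspurger1995, II.1.5] [cite: Garrett2018, §3.10] -/
theorem hfin_of_locallyUniformMajorant [NeZero N] [MeasurableSpace (quasiSplit F E c N).Adelic] [BorelSpace (quasiSplit F E c N).Adelic]
    (ν : Measure ↥(adelicUnipotent F E c N)) [IsFiniteMeasureOnCompacts ν] {f : (quasiSplit F E c N).Adelic → ℂ}
    (hf : ∀ b ∈ borelU (c : E →+* E) ((StdForm.antidiagonal N).over E), ∀ x : (quasiSplit F E c N).Adelic, f ((quasiSplit F E c N).toAdelic b * x) = f x)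
    (hcont : ∀ q : Quotient (orbitRel ↥(borelU (c : E →+* E) ((StdForm.antidiagonal N).over E)) ↥(unitaryGroupOfForm (c : E →+* E) ((StdForm.antidiagonal N).over E))),
      Continuous fun y : (quasiSplit F E c N).Adelic => f ((quasiSplit F E c N).toAdelic (q.out : ↥(unitaryGroupOfForm (c : E →+* E) ((StdForm.antidiagonal N).over E))) * y))
    (hmaj : ∀ y₀ : (quasiSplit F E c N).Adelic, ∃ U ∈ 𝓝 y₀, ∃ u : Quotient (orbitRel ↥(borelU (c : E →+* E) ((StdForm.antidiagonal N).over E))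
        ↥(unitaryGroupOfForm (c : E →+* E) ((StdForm.antidiagonal N).over E))) → ℝ, Summable u ∧ ∀ y ∈ U, ∀ q,
          ‖f ((quasiSplit F E c N).toAdelic (q.out : ↥(unitaryGroupOfForm (c : E →+* E) ((StdForm.antidiagonal N).over E))) * y)‖ ≤ u q)
    {𝓕 : Set ↥(adelicUnipotent F E c N)} (h𝓕 : IsCompact (closure 𝓕)) (g : (quasiSplit F E c N).Adelic) :
    ∫⁻ u in 𝓕, (∑' p : (quasiSplit F E c N).quotientSubgroup ⧸ (borelAdelic F E c N).subgroupOf (quasiSplit F E c N).quotientSubgroup,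
        ‖f ((((p.out : (quasiSplit F E c N).quotientSubgroup) : (quasiSplit F E c N).Adelic))⁻¹ * (u : (quasiSplit F E c N).Adelic) * g)‖ₑ) ∂ν < ∞ := by
  haveI : T2Space (quasiSplit F E c N).Adelic := inferInstanceAs (T2Space (adelic F E c N ((StdForm.antidiagonal N).over E)))
  obtain ⟨hsumL, hcontL⟩ := continuous_tsum_norm_of_locallyUniformMajorant
    (F := fun (q : Quotient (orbitRel ↥(borelU (c : E →+* E) ((StdForm.antidiagonal N).over E)) ↥(unitaryGroupOfForm (c : E →+* E) ((StdForm.antidiagonal N).over E))))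
      (y : (quasiSplit F E c N).Adelic) => f ((quasiSplit F E c N).toAdelic (q.out : ↥(unitaryGroupOfForm (c : E →+* E) ((StdForm.antidiagonal N).over E))) * y)) hcont hmaj
  -- the right-index norm series equals the left-index one, pointwise; transport summability and continuity
  have heq : ∀ y : (quasiSplit F E c N).Adelic,
      (∑' p : (quasiSplit F E c N).quotientSubgroup ⧸ (borelAdelic F E c N).subgroupOf (quasiSplit F E c N).quotientSubgroup,
        ‖f ((((p.out : (quasiSplit F E c N).quotientSubgroup) : (quasiSplit F E c N).Adelic))⁻¹ * y)‖) =
      ∑' q : Quotient (orbitRel ↥(borelU (c : E →+* E) ((StdForm.antidiagonal N).over E)) ↥(unitaryGroupOfForm (c : E →+* E) ((StdForm.antidiagonal N).over E))),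
        ‖f ((quasiSplit F E c N).toAdelic (q.out : ↥(unitaryGroupOfForm (c : E →+* E) ((StdForm.antidiagonal N).over E))) * y)‖ := fun y => by
    exact_mod_cast tsum_norm_borelQuotient_eq_tsum_norm hf y
  have hsumR : ∀ y : (quasiSplit F E c N).Adelic, Summable fun p : (quasiSplit F E c N).quotientSubgroup ⧸ (borelAdelic F E c N).subgroupOf (quasiSplit F E c N).quotientSubgroup =>
      ‖f ((((p.out : (quasiSplit F E c N).quotientSubgroup) : (quasiSplit F E c N).Adelic))⁻¹ * y)‖ := fun y => by
    obtain ⟨κ, hκ⟩ := exists_equiv_borelQuot (F := F) (E := E) (c := c) (N := N)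
    refine (Equiv.summable_iff κ).1 ((hsumL y).congr fun q => ?_)
    -- the `κ q`-term equals the `q`-term (representatives agree mod `B(F)`)
    induction q using Quotient.inductionOn with
    | h γ =>
      change ‖f ((quasiSplit F E c N).toAdelic (Quotient.mk _ γ).out * y)‖ = ‖f ((((κ (Quotient.mk _ γ)).out : (quasiSplit F E c N).quotientSubgroup) : (quasiSplit F E c N).Adelic)⁻¹ * y)‖
      rw [eisensteinSeriesU_term_eq hf γ y, hκ γ]
      obtain ⟨β, hβ⟩ := QuotientGroup.mk_out_eq_mul ((borelAdelic F E c N).subgroupOf (quasiSplit F E c N).quotientSubgroup)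
        ((⟨(quasiSplit F E c N).toAdelic γ, toAdelic_mem_quotientSubgroup γ⟩⁻¹ : (quasiSplit F E c N).quotientSubgroup))
      rw [hβ, Subgroup.coe_mul, Subgroup.coe_inv, _root_.mul_inv_rev, inv_inv, mul_assoc]
      have key := apply_mul_of_mem_borelQuotient hf (Subgroup.inv_mem _ β.2) ((quasiSplit F E c N).toAdelic γ * y)
      rw [Subgroup.coe_inv] at key
      rw [key]
  have hcontR : Continuous fun y : (quasiSplit F E c N).Adelic =>
      ∑' p : (quasiSplit F E c N).quotientSubgroup ⧸ (borelAdelic F E c N).subgroupOf (quasiSplit F E c N).quotientSubgroup,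
        ‖f ((((p.out : (quasiSplit F E c N).quotientSubgroup) : (quasiSplit F E c N).Adelic))⁻¹ * y)‖ := by
    simp_rw [heq]; exact hcontL
  have h := setLIntegral_tsum_enorm_lt_top_of_continuous (adelicUnipotent F E c N) ν
    (F := fun (p : (quasiSplit F E c N).quotientSubgroup ⧸ (borelAdelic F E c N).subgroupOf (quasiSplit F E c N).quotientSubgroup) (y : (quasiSplit F E c N).Adelic) =>
      f ((((p.out : (quasiSplit F E c N).quotientSubgroup) : (quasiSplit F E c N).Adelic))⁻¹ * y)) hsumR hcontR h𝓕 g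
  simpa only [mul_assoc] using h

end Mok

end Summit.HodgeConjecture.HodgeConjecture.Cruxes.H413.K2E1EisensteinAnalyticBinders

end
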